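import Mathlib
import HarnessLib
import Summits.NavierStokesRegularity.NavierStokesRegularity.Theorems.UnthreadedDoorPotentialEvolutionCore

/-!
# Route UnthreadedDoor · crux `PoloidalLiouville` (stmt-NavierStokesRegularity-1222, shared with
# route ThreadingFlux) · LINE «antidynamo» v2 — stub `stub_potentialEvolution` (2a-evo), file 2/2:
# the EXACT EVOLUTION LAW of the toroidal potential, VERBATIM, by localisation

Seat ns-qj-p1 g3 (director-ns KEY-NS #137), `--supports stmt-NavierStokesRegularity-1222 --as helper`.
Registered skeleton of record: planner ns-idea-6 g5, `PoloidalLiouville_antidynamo_birth_v2.lean`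
(sha16 `4ebf5683127baf3c`); this file proves its stub `StubPotentialEvolution` VERBATIM (binders
restated — a Theorems file cannot import the planner's HOME skeleton):

  for a classical solution `v` of the vorticity formulation on `(−∞,0)` (`ν = 1`) and a potential `T`,
  jointly smooth on the punctured slab `(−∞,0) × (ℝ³ ∖ {x₀})`, with `curl v(t) = ∇T(t) × (x − x₀)`:
        `∇(∂ₜT + ⟪v, ∇T⟫ − ΔT) × (x − x₀) = ∇⟪v, x − x₀⟫ × ∇T`   at every `t < 0`, `x ≠ x₀`   (E1)
  (the skeleton's three lines of vector calculus: `ω × v = (v·∇T)y − m∇T`,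
  `curl((v·∇T)y) = ∇(v·∇T) × y`, `curl(m∇T) = ∇m × ∇T`, `∂ₜω = ∇Tₜ × y`, `Δ(∇T × y) = ∇(ΔT) × y`;
  its radial component is the loop first integral `det[x − x₀, ∇m, ∇T] = 0`).

PROOF. Localisation to the computation `cross_gradient_potential_of_local` of file 1/2
(`UnthreadedDoorPotentialEvolutionCore`): at `x ≠ x₀` multiply `T` by a smooth bump `φ ≡ 1` on
`B(x, r/4)`, supported in `B̄(x, r/2)`, `r = |x − x₀|` (Mathlib `ContDiffBump`); `Θ = φT` is smooth on
the whole slab (it vanishes near `(−∞,0) × {x₀}`), represents `curl v` on `B(x, r/4)`, and has the same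
time derivative, gradient and Laplacian as `T` near `x` (`Filter.EventuallyEq.fderiv_eq`,
`InnerProductSpace.laplacian_congr_nhds`).

HONEST FRAMING: an exact identity for HYPOTHETICAL bounded ancient (blow-up profile) solutions whose
vorticity is unthreaded about `x₀`; it is the calculus stub (2a-evo) of a line whose wall
(`stub_scalarLiouville`) is OPEN. Nothing here bears on `PoloidalLiouville`, on the UnthreadedDoor
Target, or on Navier–Stokes regularity; no summit statement is proved here. [folklore]

References: A. J. Majda, A. L. Bertozzi, *Vorticity and Incompressible Flow* (CUP 2002) §1.1, Prop. 2.4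
eq. (2.110); G. Backus, Rev. Geophys. 24 (1986) §2 (Mie / toroidal–poloidal representation).
-/

noncomputable section

set_option linter.dupNamespace false

namespace Summit.NavierStokesRegularity.NavierStokesRegularity.Theorems.PoloidalLiouville

open MeasureTheory Set Function Filter
open _root_.Topology
open scoped RealInnerProductSpace InnerProductSpace ContDiff Laplacian
open Literature.Analysis.FluidPDE


/-! ### Localisation: the registered stub (potential smooth on the punctured slab) -/

/-- **Stub `stub_potentialEvolution` (2a-evo) of the registered v2 skeleton of crux `PoloidalLiouville`
(stmt-NavierStokesRegularity-1222; LINE «antidynamo», planner ns-idea-6 g5, sha16 `4ebf5683127baf3c`),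
signature VERBATIM (`StubPotentialEvolution`): the EXACT EVOLUTION LAW of the toroidal potential in curl
form.** For a classical solution `v` of the vorticity formulation on `(−∞,0)` (unit viscosity) and a
potential `T`, jointly smooth on the punctured slab `(−∞,0) × (ℝ³ ∖ {x₀})`, with
`curl v(t) = ∇T(t) × (x − x₀)` everywhere: `∇(∂ₜT + ⟪v, ∇T⟫ − ΔT) × (x − x₀) = ∇⟪v, x − x₀⟫ × ∇T` at every
`t < 0`, `x ≠ x₀`. Proof: localise — multiply `T` by a smooth bump `φ ≡ 1` near `x` supported away from
`x₀`; the product is smooth on the whole slab, represents `curl v` near `x`, and has the same time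
derivative, gradient and Laplacian as `T` near `x` — and apply `cross_gradient_potential_of_local`.
A statement about HYPOTHETICAL blow-up profiles (bounded ancient solutions); nothing here bears on
`PoloidalLiouville`, the UnthreadedDoor Target or Navier–Stokes regularity. [folklore] -/
theorem potentialEvolution :
    ∀ (v : ℝ → EuclideanSpace ℝ (Fin 3) → EuclideanSpace ℝ (Fin 3)) (x₀ : EuclideanSpace ℝ (Fin 3))
      (T : ℝ → EuclideanSpace ℝ (Fin 3) → ℝ),
      Literature.Analysis.FluidPDE.IsVorticitySolutionOn (Set.Iio 0) 1 v →
      ContDiffOn ℝ (⊤ : ℕ∞) (Function.uncurry T) (Set.Iio 0 ×ˢ ({x₀}ᶜ : Set (EuclideanSpace ℝ (Fin 3)))) →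
      (∀ t < 0, ∀ x, Literature.Analysis.FluidPDE.curl (v t) x =
        Literature.Analysis.FluidPDE.cross (gradient (T t) x) (x - x₀)) →
      ∀ t < 0, ∀ x, x ≠ x₀ →
        Literature.Analysis.FluidPDE.cross
            (gradient (fun z => deriv (fun s => T s z) t + inner ℝ (v t z) (gradient (T t) z)
              - Laplacian.laplacian (T t) z) x) (x - x₀) =
          Literature.Analysis.FluidPDE.cross (gradient (fun z => inner ℝ (v t z) (z - x₀)) x)
            (gradient (T t) x) := by
  intro v x₀ T hV hT hrep t ht x hx
  -- a bump `φ ≡ 1` on `B(x, r/4)`, supported in `B̄(x, r/2)`, `r = |x − x₀|`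
  have hr : 0 < dist x x₀ := dist_pos.2 hx
  set r : ℝ := dist x x₀ with hr_def
  let φ : ContDiffBump x := ⟨r / 4, r / 2, by positivity, by linarith⟩
  have hφ1 : ∀ z ∈ Metric.ball x (r / 4), φ z = 1 := fun z hz =>
    φ.one_of_mem_closedBall (Metric.ball_subset_closedBall hz)
  have hφ0 : (φ : (EuclideanSpace ℝ (Fin 3)) → ℝ) =ᶠ[𝓝 x₀] 0 := by
    refine notMem_tsupport_iff_eventuallyEq.1 ?_
    rw [φ.tsupport_eq]
    simp only [Metric.mem_closedBall, not_le, dist_comm x₀ x]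
    show r / 2 < r
    linarith
  -- the localised potential
  set Θ : ℝ → (EuclideanSpace ℝ (Fin 3)) → ℝ := fun s z => φ z * T s z with hΘ_def
  have hΘT : ∀ s, ∀ z ∈ Metric.ball x (r / 4), Θ s z = T s z := fun s z hz => by
    simp only [hΘ_def, hφ1 z hz, one_mul]
  have hslice : ∀ s, ∀ z ∈ Metric.ball x (r / 4), Θ s =ᶠ[𝓝 z] T s := fun s z hz => by
    filter_upwards [Metric.isOpen_ball.mem_nhds hz] with w hw
    exact hΘT s w hw
  have hgrad : ∀ s, ∀ z ∈ Metric.ball x (r / 4), gradient (Θ s) z = gradient (T s) z :=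
    fun s z hz => by rw [gradient, gradient, (hslice s z hz).fderiv_eq]
  -- (a) `Θ` is jointly smooth on the whole slab
  have hΘ : IsSmoothSpaceTimeOn (Iio 0) Θ := by
    rintro ⟨s, z⟩ ⟨hs, -⟩
    by_cases hz : z = x₀
    · -- near `(s, x₀)` the localised potential vanishes
      have h1 : (fun q : ℝ × (EuclideanSpace ℝ (Fin 3)) => (φ : (EuclideanSpace ℝ (Fin 3)) → ℝ) q.2) =ᶠ[𝓝 (s, z)] fun q => (0 : (EuclideanSpace ℝ (Fin 3)) → ℝ) q.2 := by
        have hc : Tendsto (fun q : ℝ × (EuclideanSpace ℝ (Fin 3)) => q.2) (𝓝 (s, z)) (𝓝 x₀) := by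
          rw [← hz]; exact continuous_snd.tendsto _
        exact hφ0.comp_tendsto hc
      have h2 : uncurry Θ =ᶠ[𝓝 (s, z)] fun _ => (0 : ℝ) := by
        filter_upwards [h1] with q hq
        simp only [Pi.zero_apply] at hq
        simp only [uncurry, hΘ_def, hq, zero_mul]
      exact (contDiffAt_const.congr_of_eventuallyEq h2).contDiffWithinAt
    · have hU : Iio 0 ×ˢ ({x₀}ᶜ : Set (EuclideanSpace ℝ (Fin 3))) ∈ 𝓝 ((s, z) : ℝ × (EuclideanSpace ℝ (Fin 3))) :=
        (isOpen_Iio.prod isOpen_compl_singleton).mem_nhds ⟨hs, hz⟩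
      have hTp : ContDiffAt ℝ ∞ (uncurry T) (s, z) := (hT (s, z) ⟨hs, hz⟩).contDiffAt hU
      have hφp : ContDiffAt ℝ ∞ (fun q : ℝ × (EuclideanSpace ℝ (Fin 3)) => (φ : (EuclideanSpace ℝ (Fin 3)) → ℝ) q.2) (s, z) :=
        φ.contDiff.contDiffAt.comp (s, z) contDiffAt_snd
      have h3 : uncurry Θ = fun q : ℝ × (EuclideanSpace ℝ (Fin 3)) => (φ : (EuclideanSpace ℝ (Fin 3)) → ℝ) q.2 * uncurry T q := by
        funext q; rfl
      rw [h3]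
      exact (hφp.mul hTp).contDiffWithinAt
  -- (b) the representation near `x` through `Θ`
  have hN : Metric.ball x (r / 4) ∈ 𝓝 x := Metric.isOpen_ball.mem_nhds (Metric.mem_ball_self (by positivity))
  have hrepΘ : ∀ s < 0, ∀ z ∈ Metric.ball x (r / 4), curl (v s) z = cross (gradient (Θ s) z) (z - x₀) :=
    fun s hs z hz => by rw [hgrad s z hz]; exact hrep s hs z
  -- (c) the core law for `Θ`, transferred back to `T` at `x`
  have hcore := cross_gradient_potential_of_local hV hΘ ht hN hrepΘ
  have hxB : x ∈ Metric.ball x (r / 4) := Metric.mem_ball_self (by positivity)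
  have hF : (fun z => deriv (fun s => Θ s z) t + ⟪v t z, gradient (Θ t) z⟫ - (Δ (Θ t)) z) =ᶠ[𝓝 x]
      fun z => deriv (fun s => T s z) t + ⟪v t z, gradient (T t) z⟫ - (Δ (T t)) z := by
    filter_upwards [hN] with z hz
    have e1 : (fun s => Θ s z) = fun s => T s z := funext fun s => hΘT s z hz
    rw [e1, hgrad t z hz, (InnerProductSpace.laplacian_congr_nhds (hslice t z hz)).eq_of_nhds]
  rw [gradient, hF.fderiv_eq, hgrad t x hxB] at hcore
  exact hcore

/-- Alias under the skeleton's stub name. [folklore] -/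
theorem stub_potentialEvolution :
    ∀ (v : ℝ → EuclideanSpace ℝ (Fin 3) → EuclideanSpace ℝ (Fin 3)) (x₀ : EuclideanSpace ℝ (Fin 3))
      (T : ℝ → EuclideanSpace ℝ (Fin 3) → ℝ),
      Literature.Analysis.FluidPDE.IsVorticitySolutionOn (Set.Iio 0) 1 v →
      ContDiffOn ℝ (⊤ : ℕ∞) (Function.uncurry T) (Set.Iio 0 ×ˢ ({x₀}ᶜ : Set (EuclideanSpace ℝ (Fin 3)))) →
      (∀ t < 0, ∀ x, Literature.Analysis.FluidPDE.curl (v t) x =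
        Literature.Analysis.FluidPDE.cross (gradient (T t) x) (x - x₀)) →
      ∀ t < 0, ∀ x, x ≠ x₀ →
        Literature.Analysis.FluidPDE.cross
            (gradient (fun z => deriv (fun s => T s z) t + inner ℝ (v t z) (gradient (T t) z)
              - Laplacian.laplacian (T t) z) x) (x - x₀) =
          Literature.Analysis.FluidPDE.cross (gradient (fun z => inner ℝ (v t z) (z - x₀)) x)
            (gradient (T t) x) :=
  potentialEvolution

end Summit.NavierStokesRegularity.NavierStokesRegularity.Theorems.PoloidalLiouville

end
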